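import Summits.QuantumFields.BalabanUV.Beta.GAN24.Entry115SupSdiff
import Literature.MathematicalPhysics.QuantumFieldTheory.Balaban1983to89.B5Hk163RDiv
import Literature.MathematicalPhysics.QuantumFieldTheory.Balaban1983to89.B5Hk163TorusHolderRate
import Literature.MathematicalPhysics.QuantumFieldTheory.Balaban1983to89.B5Hk160Torus
import Literature.MathematicalPhysics.QuantumFieldTheory.Balaban1983to89.B5DivOrth
import Literature.MathematicalPhysics.QuantumFieldTheory.Balaban1983to89.Beta.Ineq167Operator
import HarnessLib

/-!
# NE7SliceGreenTorus — THE SLICE SOLVER LETTER `G♭` ON THE TORUS, `k`-UNIFORMLY: for a fine vector field `x` with `Q_k x = 0` whose curl pairing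
# against `ker Q_k` is an `(ℓ¹)*`-functional of density `g`, EVERY plaquette value of `∂x` is `≤ K(d)·g` — lit-balaban's `H_k` (curl-orthogonality +
# kernel decay), B5's Landau gauge `λ₀` and `Δ_1`, and GAN24's sup bound `|∇Δ_1⁻¹J| ≤ C|J|` composed; the constant depends on the dimension ONLY

Cell `pub-balaban`, rung (B)+1 sub-cell t4, lineage `b2b-balaban-t4-ne7-p1`, generation 72 (CRUX PROVER NE7 #1).  File G1 of the G♭ discharge
(memo H14 §1 «brick 5»; the END F55 `NE7ApeTrivialFlatEndSkew(Budget)` displays G♭ as its last Bałaban TYPE at the trivial flat datum).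
WHY.  After F55, (APE) at the trivial flat datum is a kernel theorem modulo REP♭ and the slice solver letter G♭: «for a skew periodic TANGENT field `X`
at the flat background whose Hessian source has `(ℓ¹)*`-density `g` on the tangent space, `sup‖curl X‖ ≤ K·M·g`» ([B5] (1.115) second entry TYPE,
`M = L^{k+1}`, `K` independent of `k`).  THIS FILE proves the torus-side core of that letter with a constant depending on the dimension only; the sequels
transfer it to the T4 side (entries, test fields, the frame corrector) and plug it into F55.
THE ARGUMENT (ours; every input a tree theorem BY NAME).  Torus `T_η = Tor (fine n M)` (`η = 1∕n`, ANY `n ≥ 1`, ANY period vector `M`), lit-balaban's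
typed operators `Q_k = QvOp` ((1.18)), `H_k = HkOp` ((1.63)), `∂ = GradOp`, `Δ_1 = DeltaA n M 1` ((1.69)), `P = PcT` ((1.26)), the Landau gauge function
`λ₀ = lambda0` (p. 22).  Let `Q_k x = 0` and `|⟨∂a, ∂x⟩| ≤ g·‖a‖₁` for all `a ∈ ker Q_k` (curl pairing with lattice factor `c = n`, `‖a‖₁ = Σ|a|`).
(1) SOURCE: `J := ½(∂)ᴴ∂x` (ordered-pair curl) has `J(i) = ½⟨∂e_i, ∂x⟩ = ½⟨∂(e_i − H_kQ_ke_i), ∂x⟩` by lit-balaban's curl-orthogonality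
`B5Hk163RDiv.curl_HkOp_orthogonal` (`⟨∂A′, ∂H_kB⟩ = 0` for `Q_kA′ = 0`), and `e_i − H_kQ_ke_i ∈ ker Q_k` (`QvOp_HkOp_mulVec`), so `|J(i)| ≤ ½g(1 + ‖H_kQ_ke_i‖₁)
≤ ½g(1 + C_HQ(d))` — `‖Q_k‖_{ℓ¹→ℓ¹} ≤ η^{d+1}` (§1) against the column sums `Σ_{x′}|H_k(x′, y)| ≤ (d+1)·n^{d+1}·M_G·c_P·K_{d+1}` of the exponentially
decaying kernel (`B5Hk163Torus.norm_HkOp_le` + `B5Hk163TorusHolderRate.sum_exp_torusSupNorm_sub_rep_le`): the block volume CANCELS (§2).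
(2) FEYNMAN GAUGE: `x₂ := x − ∂λ₀(∂*x)` has `Q_kx₂ = 0` ((1.20) `QvOp_GradOp_mulVec` + `QsOp_lambda0`), `(1 − P)∂*x₂ = 0` (`residual_lambda0`, `PcT_mulVec_idem`)
and the same curl (`Fs_grad`); hence `Δ_1x₂ = ½∂ᴴ∂x₂ + ∂(1−P)∂*x₂ + Q*Qx₂ = J` (`DeltaA_eq_curl`) and `x₂ = Δ_1⁻¹J` (`solution_eq`) (§4).
(3) `F_{μν}(x) = F_{μν}(x₂) = (∇_μΔ_1⁻¹J)_ν − (∇_νΔ_1⁻¹J)_μ`, and GAN24's `Entry110Rect.norm_fdiff_inv_mulVec_le` (`|∇_νΔ_1⁻¹J| ≤ C(d)|J|_∞`, EVERY `n`, EVERY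
torus) gives **`|F_{μν}(x)(t)| ≤ C(d)·(1 + C_HQ(d))·g`** (§5 `exists_sliceGreen_const`).  In the T4 lattice currency (`curl₁ = η·F`, pairings `η²`, sources
per unit `ℓ¹`) this is the `K·M` of memo H14 §1 CURRENCY FACT 1 — the sequel's bookkeeping.
WHAT ([folklore]; 0 def, 0 sorry; dimension `d + 1`).  §1 `sum_norm_QvOp_mulVec_le`; §2 `sum_norm_HkOp_col_le`, `sum_norm_HkOp_mulVec_le`,
`sum_norm_HkOp_QvOp_mulVec_le`; §3 `curlAdjCurl_mulVec_apply`, `norm_curlAdjCurl_mulVec_le`; §4 `Fs_eq_fdiff_DeltaA_inv` (the Feynman-gauge representation of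
the curl of a `ker Q_k` field); §5 **`exists_sliceGreen_const`**.
HONEST FRAMING (page 1): a composition of tree theorems at `U = 1` (abelian∕flat, every matrix entry separately in the sequel); the constant is GAN24's
existential `C(d)` times lit-balaban's decay constants — a function of the dimension only, NOT a printed `O(1)`; [B5] (1.115) p. 36 is a TEXT LOCATION, nothing
printed is asserted; NOT (APE), NOT ONE-STEP, NOT NE7; spine 0∕9; finite T⁴ rung (B)+1 — NOT infinite volume, NOT mass gap, NOT Clay.  Continuum YM on T⁴ ⇐
BetaPertH ∧ nine spine estimates (0/9 proved); BetaPertH ⇐ (D1) ∧ (D4) ∧ CAP+tail; G-an2-4 gates asym, D1 and NE2/3/4.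
-/

set_option autoImplicit false

open scoped BigOperators Matrix ComplexConjugate
open Finset

namespace Summit.QuantumFields.BalabanUV.T4Continuum.NE7SliceGreenTorus

open Literature.MathematicalPhysics.QuantumFieldTheory.Balaban1983to89
open B5Prop11Plancherel (Tor fine fdiff unitVec)
open B5Action121 (Fs Fs_apply GradOp GradOp_mulVec sdiff_mulVec CurlOp CurlOp_mulVec pd comp LapS GradOp_conjTranspose_mul_GradOp)
open B5Block118 (QvOp QvOp_mulVec lineSum bpt tstep QsOp)
open B5Blocks16 (bpt_bijective)
open B5DeltaA169 (DeltaA DeltaA_eq_curl QvAdj solution_eq calG_eq_DeltaA_inv)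
open B5Value126 (PcT lambda0 residual_lambda0 QsOp_lambda0 PcT_mulVec_idem)
open B5Hk160Torus (QvOp_GradOp_mulVec)
open B5Hk163Torus (HkOp QvOp_HkOp_mulVec norm_HkOp_le)
open B5Hk163RDiv (curl_HkOp_orthogonal)
open B5Hk163Strip (kappa163 kappa163_pos)
open B5Hk163Decay (MG163 MG163_nonneg)
open B4TorusKernel (periodConst)
open B4TorusKernel.MultiPeriod (torusSupNorm)
open B4Sect5Proof (latticeConst latticeConst_nonneg)
open B4Sect5Torus (circAbs_neg)
open B5Kernel166Decay (periodConst_pos)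
open B5Hk163TorusHolderRate (sum_exp_torusSupNorm_sub_rep_le)
open B6LowerBound2153Torus (toT rep toT_rep)
open B6Cov2156Torus (one_le_M)
open B5DivOrth (sum_GradOp_adjoint)
open Beta.GAN24.Entry110Rect (norm_fdiff_inv_mulVec_le)
open B5G183FreeRowSum (fdiff_mulVec)

noncomputable section

variable {d : ℕ}

/-! ## §1 The block average `Q_k` in `ℓ¹`: `Σ_b |(Q_kA)_b| ≤ η^{d+1}·Σ_i |A_i|` -/

section Average

variable (n : ℕ) [NeZero n] (M : Fin (d + 1) → ℕ) [∀ μ, NeZero (M μ)]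

/-- **`‖Q_kA‖₁ ≤ η^{d+1}‖A‖₁`** (dimension `d + 1`, `η = 1∕n`): every fine bond lies on exactly `n` of the straight contours of (1.18), each weighted
`η^{d+2}`. [folklore] -/
theorem sum_norm_QvOp_mulVec_le (A : Tor (fine n M) × Fin (d + 1) → ℂ) :
    ∑ b, ‖(QvOp n M *ᵥ A) b‖ ≤ (1 / (n : ℝ) ^ (d + 1)) * ∑ i, ‖A i‖ := by
  have hn : (0 : ℝ) < n := by exact_mod_cast Nat.pos_of_ne_zero (NeZero.ne n)
  -- pointwise: `|(Q_kA)(y,μ)| ≤ η^{d+2} Σ_j Σ_t |A(ny+j+t e_μ, μ)|`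
  have hpt : ∀ (y : Tor M) (μ : Fin (d + 1)),
      ‖(QvOp n M *ᵥ A) (y, μ)‖ ≤ (1 / (n : ℝ) ^ (d + 1 + 1)) * ∑ j : Fin (d + 1) → Fin n, ∑ t : Fin n, ‖A (bpt n M y j + tstep (fine n M) μ t, μ)‖ := by
    intro y μ
    rw [QvOp_mulVec, norm_mul]
    have hc : ‖(1 / (n : ℂ) ^ (d + 1 + 1))‖ = 1 / (n : ℝ) ^ (d + 1 + 1) := by
      rw [norm_div, norm_one, norm_pow, Complex.norm_natCast]
    rw [hc]
    refine mul_le_mul_of_nonneg_left ((norm_sum_le _ _).trans (Finset.sum_le_sum fun j _ => ?_)) (by positivity)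
    simp only [lineSum]
    exact norm_sum_le _ _
  -- sum over coarse bonds, then reassemble the fine torus block by block and shift the lines back
  calc ∑ b, ‖(QvOp n M *ᵥ A) b‖
      = ∑ μ : Fin (d + 1), ∑ y : Tor M, ‖(QvOp n M *ᵥ A) (y, μ)‖ := by
        rw [Fintype.sum_prod_type, Finset.sum_comm]
    _ ≤ ∑ μ : Fin (d + 1), ∑ y : Tor M, (1 / (n : ℝ) ^ (d + 1 + 1))
          * ∑ j : Fin (d + 1) → Fin n, ∑ t : Fin n, ‖A (bpt n M y j + tstep (fine n M) μ t, μ)‖ :=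
        Finset.sum_le_sum fun μ _ => Finset.sum_le_sum fun y _ => hpt y μ
    _ = (1 / (n : ℝ) ^ (d + 1 + 1)) * ∑ μ : Fin (d + 1), ∑ t : Fin n, ∑ x : Tor (fine n M), ‖A (x + tstep (fine n M) μ t, μ)‖ := by
        rw [Finset.mul_sum]
        refine Finset.sum_congr rfl fun μ _ => ?_
        rw [← Finset.mul_sum]
        congr 1
        have hb := (bpt_bijective n M).sum_comp (fun x : Tor (fine n M) => ∑ t : Fin n, ‖A (x + tstep (fine n M) μ t, μ)‖)
        rw [Fintype.sum_prod_type] at hb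
        calc ∑ y : Tor M, ∑ j : Fin (d + 1) → Fin n, ∑ t : Fin n, ‖A (bpt n M y j + tstep (fine n M) μ t, μ)‖
            = ∑ x : Tor (fine n M), ∑ t : Fin n, ‖A (x + tstep (fine n M) μ t, μ)‖ := hb
          _ = ∑ t : Fin n, ∑ x : Tor (fine n M), ‖A (x + tstep (fine n M) μ t, μ)‖ := Finset.sum_comm
    _ = (1 / (n : ℝ) ^ (d + 1 + 1)) * ∑ μ : Fin (d + 1), ∑ _t : Fin n, ∑ x : Tor (fine n M), ‖A (x, μ)‖ := by
        congr 1
        refine Finset.sum_congr rfl fun μ _ => Finset.sum_congr rfl fun t _ => ?_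
        exact Fintype.sum_equiv (Equiv.addRight (tstep (fine n M) μ t)) _ _ fun x => rfl
    _ = (1 / (n : ℝ) ^ (d + 1 + 1)) * ((n : ℝ) * ∑ i, ‖A i‖) := by
        congr 1
        simp only [Finset.sum_const, Finset.card_univ, Fintype.card_fin, nsmul_eq_mul]
        rw [← Finset.mul_sum, Fintype.sum_prod_type_right]
    _ = (1 / (n : ℝ) ^ (d + 1)) * ∑ i, ‖A i‖ := by
        field_simp
        ring

end Average

/-! ## §2 Column sums of lit-balaban's `H_k`: the block volume cancels against §1 -/

section Columns

variable (n : ℕ) [NeZero n] (M : Fin (d + 1) → ℕ) [∀ μ, NeZero (M μ)]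

/-- **COLUMN SUMS OF `H_k`**: `Σ_{(x′,μ)} |H_k((x′,μ),(y,λ))| ≤ (d+1)·n^{d+1}·M_G·c_P·K_{d+1}` for every coarse bond `(y, λ)` — lit-balaban's kernel decay
`norm_HkOp_le` summed block by block (`n^{d+1}` offsets per block, `d+1` directions) with the volume-uniform torus sum `sum_exp_torusSupNorm_sub_rep_le`. [folklore] -/
theorem sum_norm_HkOp_col_le (y : Tor M) (lam : Fin (d + 1)) :
    ∑ i : Tor (fine n M) × Fin (d + 1), ‖HkOp n M i (y, lam)‖
      ≤ ((d + 1 : ℕ) : ℝ) * (n : ℝ) ^ (d + 1)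
          * (MG163 (d + 1) * periodConst (kappa163 (d + 1)) d * latticeConst (d + 1) (kappa163 (d + 1) / (d + 1))) := by
  have hκ : 0 < kappa163 (d + 1) / (d + 1) := div_pos (kappa163_pos (d + 1)) (by positivity)
  have hMG := MG163_nonneg (d + 1)
  have hpC := (periodConst_pos (kappa163_pos (d + 1)) d).le
  -- one entry
  have hent : ∀ (μ : Fin (d + 1)) (y' : Tor M) (a : Fin (d + 1) → Fin n),
      ‖HkOp n M (bpt n M y' a, μ) (y, lam)‖
        ≤ MG163 (d + 1) * periodConst (kappa163 (d + 1)) d * Real.exp (-(kappa163 (d + 1) / (d + 1) * torusSupNorm M (rep M y - rep M y'))) := by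
    intro μ y' a
    have h := norm_HkOp_le n M μ lam a (rep M y') (rep M y)
    rw [toT_rep, toT_rep] at h
    have hsym : torusSupNorm M (rep M y' - rep M y) = torusSupNorm M (rep M y - rep M y') := by
      rw [← neg_sub]
      unfold torusSupNorm
      congr 1
      funext i
      rw [Pi.neg_apply, circAbs_neg (one_le_M M i)]
    rw [hsym] at h
    exact h
  -- the torus sum
  have htor := sum_exp_torusSupNorm_sub_rep_le M hκ (rep M y)
  calc ∑ i : Tor (fine n M) × Fin (d + 1), ‖HkOp n M i (y, lam)‖
      = ∑ μ : Fin (d + 1), ∑ x : Tor (fine n M), ‖HkOp n M (x, μ) (y, lam)‖ := by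
        rw [Fintype.sum_prod_type, Finset.sum_comm]
    _ = ∑ μ : Fin (d + 1), ∑ y' : Tor M, ∑ a : Fin (d + 1) → Fin n, ‖HkOp n M (bpt n M y' a, μ) (y, lam)‖ := by
        refine Finset.sum_congr rfl fun μ _ => ?_
        have hb := (bpt_bijective n M).sum_comp (fun x : Tor (fine n M) => ‖HkOp n M (x, μ) (y, lam)‖)
        rw [Fintype.sum_prod_type] at hb
        exact hb.symm
    _ ≤ ∑ _μ : Fin (d + 1), ∑ y' : Tor M, ∑ _a : Fin (d + 1) → Fin n,
          MG163 (d + 1) * periodConst (kappa163 (d + 1)) d * Real.exp (-(kappa163 (d + 1) / (d + 1) * torusSupNorm M (rep M y - rep M y'))) :=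
        Finset.sum_le_sum fun μ _ => Finset.sum_le_sum fun y' _ => Finset.sum_le_sum fun a _ => hent μ y' a
    _ = ((d + 1 : ℕ) : ℝ) * (n : ℝ) ^ (d + 1)
          * (MG163 (d + 1) * periodConst (kappa163 (d + 1)) d
              * ∑ y' : Tor M, Real.exp (-(kappa163 (d + 1) / (d + 1) * torusSupNorm M (rep M y - rep M y')))) := by
        have hsumA : ∀ c : ℝ, ∑ _a : Fin (d + 1) → Fin n, c = (n : ℝ) ^ (d + 1) * c := fun c => by
          rw [Finset.sum_const, Finset.card_univ, Fintype.card_fun, Fintype.card_fin, Fintype.card_fin, nsmul_eq_mul]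
          push_cast
          ring
        have hsumμ : ∀ c : ℝ, ∑ _μ : Fin (d + 1), c = ((d + 1 : ℕ) : ℝ) * c := fun c => by
          rw [Finset.sum_const, Finset.card_univ, Fintype.card_fin, nsmul_eq_mul]
        simp only [hsumA]
        rw [hsumμ, ← Finset.mul_sum, ← Finset.mul_sum]
        ring
    _ ≤ ((d + 1 : ℕ) : ℝ) * (n : ℝ) ^ (d + 1)
          * (MG163 (d + 1) * periodConst (kappa163 (d + 1)) d * latticeConst (d + 1) (kappa163 (d + 1) / (d + 1))) :=
        mul_le_mul_of_nonneg_left (mul_le_mul_of_nonneg_left htor (mul_nonneg hMG hpC)) (by positivity)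

/-- hence **`‖H_kB‖₁ ≤ (d+1)·n^{d+1}·M_G·c_P·K_{d+1}·‖B‖₁`**. [folklore] -/
theorem sum_norm_HkOp_mulVec_le (B : Tor M × Fin (d + 1) → ℂ) :
    ∑ i : Tor (fine n M) × Fin (d + 1), ‖(HkOp n M *ᵥ B) i‖
      ≤ ((d + 1 : ℕ) : ℝ) * (n : ℝ) ^ (d + 1)
          * (MG163 (d + 1) * periodConst (kappa163 (d + 1)) d * latticeConst (d + 1) (kappa163 (d + 1) / (d + 1))) * ∑ b, ‖B b‖ := by
  calc ∑ i : Tor (fine n M) × Fin (d + 1), ‖(HkOp n M *ᵥ B) i‖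
      ≤ ∑ i : Tor (fine n M) × Fin (d + 1), ∑ b, ‖HkOp n M i b‖ * ‖B b‖ := by
        refine Finset.sum_le_sum fun i _ => ?_
        rw [Matrix.mulVec, dotProduct]
        exact (norm_sum_le _ _).trans (Finset.sum_le_sum fun b _ => (norm_mul_le _ _))
    _ = ∑ b, (∑ i : Tor (fine n M) × Fin (d + 1), ‖HkOp n M i b‖) * ‖B b‖ := by
        rw [Finset.sum_comm]
        refine Finset.sum_congr rfl fun b _ => ?_
        rw [Finset.sum_mul]
    _ ≤ ∑ b, (((d + 1 : ℕ) : ℝ) * (n : ℝ) ^ (d + 1)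
          * (MG163 (d + 1) * periodConst (kappa163 (d + 1)) d * latticeConst (d + 1) (kappa163 (d + 1) / (d + 1)))) * ‖B b‖ := by
        refine Finset.sum_le_sum fun b _ => mul_le_mul_of_nonneg_right ?_ (norm_nonneg _)
        obtain ⟨y, lam⟩ := b
        exact sum_norm_HkOp_col_le n M y lam
    _ = _ := by rw [← Finset.mul_sum]

/-- **`‖H_kQ_kA‖₁ ≤ C_HQ(d)·‖A‖₁`, `C_HQ(d) = (d+1)·M_G·c_P·K_{d+1}`** — the block volume `n^{d+1}` of §2 cancels the `η^{d+1}` of §1: the projection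
`A ↦ A − H_kQ_kA` onto `ker Q_k` is `ℓ¹`-bounded UNIFORMLY in `n` and in the torus. [folklore] -/
theorem sum_norm_HkOp_QvOp_mulVec_le (A : Tor (fine n M) × Fin (d + 1) → ℂ) :
    ∑ i : Tor (fine n M) × Fin (d + 1), ‖(HkOp n M *ᵥ (QvOp n M *ᵥ A)) i‖
      ≤ ((d + 1 : ℕ) : ℝ) * (MG163 (d + 1) * periodConst (kappa163 (d + 1)) d * latticeConst (d + 1) (kappa163 (d + 1) / (d + 1)))
          * ∑ i, ‖A i‖ := by
  have hn : (0 : ℝ) < n := by exact_mod_cast Nat.pos_of_ne_zero (NeZero.ne n)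
  have hκ : 0 < kappa163 (d + 1) / (d + 1) := div_pos (kappa163_pos (d + 1)) (by positivity)
  have hK : 0 ≤ MG163 (d + 1) * periodConst (kappa163 (d + 1)) d * latticeConst (d + 1) (kappa163 (d + 1) / (d + 1)) :=
    mul_nonneg (mul_nonneg (MG163_nonneg _) (periodConst_pos (kappa163_pos (d + 1)) d).le) (latticeConst_nonneg _ hκ.le)
  have h1 := sum_norm_HkOp_mulVec_le n M (QvOp n M *ᵥ A)
  have h2 := sum_norm_QvOp_mulVec_le n M A
  have hA : 0 ≤ ∑ i, ‖A i‖ := Finset.sum_nonneg fun _ _ => norm_nonneg _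
  calc _ ≤ ((d + 1 : ℕ) : ℝ) * (n : ℝ) ^ (d + 1)
          * (MG163 (d + 1) * periodConst (kappa163 (d + 1)) d * latticeConst (d + 1) (kappa163 (d + 1) / (d + 1)))
          * ((1 / (n : ℝ) ^ (d + 1)) * ∑ i, ‖A i‖) := h1.trans (mul_le_mul_of_nonneg_left h2 (by positivity))
    _ = _ := by field_simp

end Columns

/-! ## §3 The source `J = ½∂ᴴ∂x` of a `ker Q_k` field is bounded pointwise by the slice density of its curl pairing -/

section Source

variable (n : ℕ) [NeZero n] (M : Fin (d + 1) → ℕ) [∀ μ, NeZero (M μ)]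

/-- `(∂ᴴ∂x)(i) = ⟨∂e_i, ∂x⟩`. [folklore] -/
theorem curlAdjCurl_mulVec_apply (x : Tor (fine n M) × Fin (d + 1) → ℂ) (i : Tor (fine n M) × Fin (d + 1)) :
    (((CurlOp (fine n M) (n : ℂ))ᴴ * CurlOp (fine n M) (n : ℂ)) *ᵥ x) i
      = star (CurlOp (fine n M) (n : ℂ) *ᵥ Pi.single i 1) ⬝ᵥ (CurlOp (fine n M) (n : ℂ) *ᵥ x) := by
  rw [← Matrix.mulVec_mulVec, Matrix.mulVec, dotProduct, dotProduct]
  refine Finset.sum_congr rfl fun p _ => ?_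
  rw [Matrix.conjTranspose_apply, Pi.star_apply, Matrix.mulVec_single_one, Matrix.col_apply]

/-- **THE SOURCE BOUND**: if `Q_kx = 0` and `|⟨∂a, ∂x⟩| ≤ g‖a‖₁` on `ker Q_k`, then `|(∂ᴴ∂x)(i)| ≤ (1 + C_HQ(d))·g` at every bond `i` — test with
`a := e_i − H_kQ_ke_i ∈ ker Q_k` (lit-balaban's `Q_kH_k = 1`); the correction is invisible to the pairing by lit-balaban's curl-orthogonality
`⟨∂A′, ∂H_kB⟩ = 0` (`Q_kA′ = 0`), and costs `C_HQ(d)` in `ℓ¹` (§2). [folklore] -/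
theorem norm_curlAdjCurl_mulVec_le (x : Tor (fine n M) × Fin (d + 1) → ℂ) (hx : QvOp n M *ᵥ x = 0) {g : ℝ} (hg0 : 0 ≤ g)
    (hg : ∀ a : Tor (fine n M) × Fin (d + 1) → ℂ, QvOp n M *ᵥ a = 0 →
      ‖star (CurlOp (fine n M) (n : ℂ) *ᵥ a) ⬝ᵥ (CurlOp (fine n M) (n : ℂ) *ᵥ x)‖ ≤ g * ∑ j, ‖a j‖)
    (i : Tor (fine n M) × Fin (d + 1)) :
    ‖(((CurlOp (fine n M) (n : ℂ))ᴴ * CurlOp (fine n M) (n : ℂ)) *ᵥ x) i‖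
      ≤ (1 + ((d + 1 : ℕ) : ℝ) * (MG163 (d + 1) * periodConst (kappa163 (d + 1)) d * latticeConst (d + 1) (kappa163 (d + 1) / (d + 1)))) * g := by
  set C := CurlOp (fine n M) (n : ℂ) with hC
  set e : Tor (fine n M) × Fin (d + 1) → ℂ := Pi.single i 1 with he
  set h : Tor (fine n M) × Fin (d + 1) → ℂ := HkOp n M *ᵥ (QvOp n M *ᵥ e) with hh
  -- the test field `a = e − h` lies in `ker Q_k`
  have ha : QvOp n M *ᵥ (e - h) = 0 := by
    rw [Matrix.mulVec_sub, hh, QvOp_HkOp_mulVec, sub_self]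
  -- the lift is curl-orthogonal to `x`
  have horth : star (C *ᵥ h) ⬝ᵥ (C *ᵥ x) = 0 := by
    have h0 := curl_HkOp_orthogonal n M (QvOp n M *ᵥ e) x hx
    rw [← hC, ← hh] at h0
    rw [Matrix.star_dotProduct, h0, star_zero]
  have hsplit : star (C *ᵥ e) ⬝ᵥ (C *ᵥ x) = star (C *ᵥ (e - h)) ⬝ᵥ (C *ᵥ x) := by
    rw [Matrix.mulVec_sub, star_sub, sub_dotProduct, horth, sub_zero]
  -- the `ℓ¹` size of the test field
  have hl1 : ∑ j, ‖(e - h) j‖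
      ≤ 1 + ((d + 1 : ℕ) : ℝ) * (MG163 (d + 1) * periodConst (kappa163 (d + 1)) d * latticeConst (d + 1) (kappa163 (d + 1) / (d + 1))) := by
    have he1 : ∑ j, ‖e j‖ = 1 := by
      rw [Finset.sum_eq_single i (fun j _ hj => by rw [he, Pi.single_eq_of_ne hj, norm_zero]) (fun hi => absurd (Finset.mem_univ i) hi),
        he, Pi.single_eq_same, norm_one]
    calc ∑ j, ‖(e - h) j‖ ≤ ∑ j, (‖e j‖ + ‖h j‖) := Finset.sum_le_sum fun j _ => norm_sub_le _ _
      _ = 1 + ∑ j, ‖h j‖ := by rw [Finset.sum_add_distrib, he1]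
      _ ≤ _ := by
          have h2 := sum_norm_HkOp_QvOp_mulVec_le n M e
          rw [he1, mul_one] at h2
          rw [hh]
          linarith
  rw [curlAdjCurl_mulVec_apply, ← he, ← hC, hsplit]
  calc ‖star (C *ᵥ (e - h)) ⬝ᵥ (C *ᵥ x)‖ ≤ g * ∑ j, ‖(e - h) j‖ := hg (e - h) ha
    _ ≤ g * (1 + ((d + 1 : ℕ) : ℝ) * (MG163 (d + 1) * periodConst (kappa163 (d + 1)) d * latticeConst (d + 1) (kappa163 (d + 1) / (d + 1)))) :=
        mul_le_mul_of_nonneg_left hl1 hg0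
    _ = _ := mul_comm _ _

end Source

/-! ## §4 The Feynman-gauge representation of the curl of a `ker Q_k` field: `∂x = ∂Δ_1⁻¹(½∂ᴴ∂x)` -/

section Gauge

variable (n : ℕ) [NeZero n] (M : Fin (d + 1) → ℕ) [∀ μ, NeZero (M μ)]

/-- the ordered-pair curl of a pure gauge vanishes, as a vector. [folklore] -/
theorem CurlOp_mulVec_GradOp (l : Tor (fine n M) → ℂ) :
    CurlOp (fine n M) (n : ℂ) *ᵥ (GradOp (fine n M) (n : ℂ) *ᵥ l) = 0 := by
  funext p
  obtain ⟨t, μ, ν⟩ := p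
  rw [CurlOp_mulVec, Beta.Ineq167Operator.Fs_grad, Pi.zero_apply]

/-- **FEYNMAN GAUGE**: for `Q_kx = 0` and `J := ½∂ᴴ∂x`, every plaquette value of `x` is read off `Δ_1⁻¹J`:
`F_{μν}(x)(t) = (∇_μΔ_1⁻¹J)(t,ν) − (∇_νΔ_1⁻¹J)(t,μ)`.  PROOF: gauge away `(1−P)∂*x` by B5's `λ₀` (`residual_lambda0`: `∂*x − Δλ₀ = P∂*x`, `Q′_kλ₀ = 0`);
the gauged field `x₂ = x − ∂λ₀` keeps `Q_kx₂ = 0` ((1.20)) and the curl, and `Δ_1x₂ = ½∂ᴴ∂x₂ + ∂(1−P)∂*x₂ + Q*_kQ_kx₂ = J` (`DeltaA_eq_curl`), so `x₂ = Δ_1⁻¹J`.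
[cite: Balaban1984PropagatorsI, (1.69)–(1.73) pp.29–30, Sect. C p.22 (text locations; composition ours)] -/
theorem Fs_eq_fdiff_DeltaA_inv (x : Tor (fine n M) × Fin (d + 1) → ℂ) (hx : QvOp n M *ᵥ x = 0) (μ ν : Fin (d + 1)) (t : Tor (fine n M)) :
    Fs (fine n M) (n : ℂ) x μ ν t
      = (fdiff (fine n M) (n : ℂ) μ *ᵥ ((DeltaA n M 1)⁻¹ *ᵥ
            ((1 / 2 : ℂ) • (((CurlOp (fine n M) (n : ℂ))ᴴ * CurlOp (fine n M) (n : ℂ)) *ᵥ x)))) (t, ν)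
        - (fdiff (fine n M) (n : ℂ) ν *ᵥ ((DeltaA n M 1)⁻¹ *ᵥ
            ((1 / 2 : ℂ) • (((CurlOp (fine n M) (n : ℂ))ᴴ * CurlOp (fine n M) (n : ℂ)) *ᵥ x)))) (t, μ) := by
  have hn1 : 1 ≤ n := Nat.one_le_iff_ne_zero.mpr (NeZero.ne n)
  have hc : (n : ℂ) ≠ 0 := by exact_mod_cast NeZero.ne n
  set C := CurlOp (fine n M) (n : ℂ) with hC
  set D := GradOp (fine n M) (n : ℂ) with hD
  set J : Tor (fine n M) × Fin (d + 1) → ℂ := (1 / 2 : ℂ) • ((Cᴴ * C) *ᵥ x) with hJ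
  -- the Landau gauge function of B5 Sect. C for `b = ∂*x`
  set b : Tor (fine n M) → ℂ := Dᴴ *ᵥ x with hb
  have hb0 : ∑ y, b y = 0 := by rw [hb, hD]; exact sum_GradOp_adjoint (fine n M) (n : ℂ) x
  set l₀ := lambda0 n M (n : ℂ) b with hl₀
  set x₂ : Tor (fine n M) × Fin (d + 1) → ℂ := x - D *ᵥ l₀ with hx₂
  -- (i) the gauge condition `(1 − P)∂*x₂ = 0`
  have hdiv : Dᴴ *ᵥ x₂ = PcT n M (n : ℂ) *ᵥ b := by
    rw [hx₂, Matrix.mulVec_sub, Matrix.mulVec_mulVec, hD, GradOp_conjTranspose_mul_GradOp, ← hD, ← hb]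
    exact residual_lambda0 n M (n : ℂ) hc b hb0
  have hgauge : (1 - PcT n M (n : ℂ)) *ᵥ (Dᴴ *ᵥ x₂) = 0 := by
    rw [hdiv, Matrix.sub_mulVec, Matrix.one_mulVec, PcT_mulVec_idem n M (n : ℂ) hc b, sub_self]
  -- (ii) the averaging constraint survives the gauge transformation
  have hQ : QvOp n M *ᵥ x₂ = 0 := by
    rw [hx₂, Matrix.mulVec_sub, hx, hD, QvOp_GradOp_mulVec, hl₀, QsOp_lambda0 n M (n : ℂ) hc b, Matrix.mulVec_zero, sub_zero]
  -- (iii) the curl is unchanged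
  have hcurl : C *ᵥ x₂ = C *ᵥ x := by
    rw [hx₂, Matrix.mulVec_sub, hC, hD, CurlOp_mulVec_GradOp, sub_zero]
  -- (iv) `Δ_1 x₂ = J`
  have hΔ : DeltaA n M 1 *ᵥ x₂ = J := by
    rw [DeltaA_eq_curl n M (1 : ℝ), ← hC, ← hD]
    simp only [Matrix.add_mulVec, Matrix.smul_mulVec, ← Matrix.mulVec_mulVec]
    rw [hgauge, Matrix.mulVec_zero, add_zero, hQ, Matrix.mulVec_zero, smul_zero, add_zero, hcurl, hJ, Matrix.mulVec_mulVec]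
  -- (v) hence `x₂ = Δ_1⁻¹ J`
  have hsol : x₂ = (DeltaA n M 1)⁻¹ *ᵥ J := by
    rw [← calG_eq_DeltaA_inv n hn1 M 1 one_pos]
    exact solution_eq n hn1 M 1 one_pos hΔ
  -- (vi) read the plaquette value on `x₂`
  have hFs : Fs (fine n M) (n : ℂ) x μ ν t = Fs (fine n M) (n : ℂ) x₂ μ ν t := by
    have hsplit : x = x₂ + D *ᵥ l₀ := by rw [hx₂]; abel
    conv_lhs => rw [hsplit]
    rw [Beta.Ineq167Operator.Fs_add, hD, Beta.Ineq167Operator.Fs_grad, add_zero]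
  rw [hFs, ← hsol]
  show pd (fine n M) (n : ℂ) x₂ μ ν t - pd (fine n M) (n : ℂ) x₂ ν μ t = _
  rw [pd, pd, sdiff_mulVec, sdiff_mulVec, fdiff_mulVec, fdiff_mulVec]
  rfl

end Gauge

/-! ## §5 THE END (torus side): the slice Green letter with a dimension-only constant -/

/-- **THE SLICE SOLVER LETTER ON THE TORUS, `k`-UNIFORM** (dimension `d + 1`): there is `K > 0` depending on `d` only such that for EVERY `n ≥ 1`, EVERY
period vector `M`, every fine vector field `x` with `Q_kx = 0`, every `g ≥ 0` with `|⟨∂a, ∂x⟩| ≤ g·Σ|a|` for all `a ∈ ker Q_k` (curl pairing at lattice factor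
`n`), and every plaquette: `|F_{μν}(x)(t)| ≤ K·g`.  `K = 2·C(d)·½(1 + C_HQ(d))` with GAN24's `C(d)` of `Entry110Rect.norm_fdiff_inv_mulVec_le` (§4 + §3). [folklore] -/
theorem exists_sliceGreen_const :
    ∃ K : ℝ, 0 < K ∧ ∀ (n : ℕ) [NeZero n] (M : Fin (d + 1) → ℕ) [∀ μ, NeZero (M μ)]
      (x : Tor (fine n M) × Fin (d + 1) → ℂ), QvOp n M *ᵥ x = 0 → ∀ g : ℝ, 0 ≤ g →
      (∀ a : Tor (fine n M) × Fin (d + 1) → ℂ, QvOp n M *ᵥ a = 0 →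
        ‖star (CurlOp (fine n M) (n : ℂ) *ᵥ a) ⬝ᵥ (CurlOp (fine n M) (n : ℂ) *ᵥ x)‖ ≤ g * ∑ j, ‖a j‖) →
      ∀ (μ ν : Fin (d + 1)) (t : Tor (fine n M)), ‖Fs (fine n M) (n : ℂ) x μ ν t‖ ≤ K * g := by
  obtain ⟨C, hC, hgrad⟩ := norm_fdiff_inv_mulVec_le (d := d)
  have hκ : 0 < kappa163 (d + 1) / (d + 1) := div_pos (kappa163_pos (d + 1)) (by positivity)
  set CHQ := ((d + 1 : ℕ) : ℝ) * (MG163 (d + 1) * periodConst (kappa163 (d + 1)) d * latticeConst (d + 1) (kappa163 (d + 1) / (d + 1))) with hCHQ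
  have hCHQ0 : 0 ≤ CHQ := mul_nonneg (by positivity)
    (mul_nonneg (mul_nonneg (MG163_nonneg _) (periodConst_pos (kappa163_pos (d + 1)) d).le) (latticeConst_nonneg _ hκ.le))
  refine ⟨C * (1 + CHQ), by positivity, fun n _ M _ x hx g hg0 hg μ ν t => ?_⟩
  set J : Tor (fine n M) × Fin (d + 1) → ℂ :=
    (1 / 2 : ℂ) • (((CurlOp (fine n M) (n : ℂ))ᴴ * CurlOp (fine n M) (n : ℂ)) *ᵥ x) with hJ
  -- the sup norm of the source
  have hJB : ∀ j, ‖J j‖ ≤ (1 / 2) * ((1 + CHQ) * g) := by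
    intro j
    rw [hJ, Pi.smul_apply, norm_smul]
    have h12 : ‖(1 / 2 : ℂ)‖ = 1 / 2 := by rw [norm_div, norm_one, Complex.norm_ofNat]
    rw [h12]
    exact mul_le_mul_of_nonneg_left (norm_curlAdjCurl_mulVec_le n M x hx hg0 hg j) (by norm_num)
  -- the two gradient entries
  have h1 := hgrad n M μ J _ hJB (t, ν)
  have h2 := hgrad n M ν J _ hJB (t, μ)
  rw [Fs_eq_fdiff_DeltaA_inv n M x hx μ ν t, ← hJ]
  calc _ ≤ ‖(fdiff (fine n M) (n : ℂ) μ *ᵥ ((DeltaA n M 1)⁻¹ *ᵥ J)) (t, ν)‖ + ‖(fdiff (fine n M) (n : ℂ) ν *ᵥ ((DeltaA n M 1)⁻¹ *ᵥ J)) (t, μ)‖ :=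
        norm_sub_le _ _
    _ ≤ C * (1 / 2 * ((1 + CHQ) * g)) + C * (1 / 2 * ((1 + CHQ) * g)) := add_le_add h1 h2
    _ = C * (1 + CHQ) * g := by ring

end

end Summit.QuantumFields.BalabanUV.T4Continuum.NE7SliceGreenTorus
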